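import Mathlib
import Summits.NavierStokesRegularity.NavierStokesRegularity.Theorems.EulerZoomLiouvillePowerGaugeEulerLiouvilleCondenserSpecksOnQuietSlice
import Summits.NavierStokesRegularity.NavierStokesRegularity.Theorems.EulerZoomLiouvillePowerGaugeEulerLiouvilleCondenserCrossings

/-!
# SPECKS ON THE QUIET SLICE — general orthonormal frame (plate t47-F′, nsreg-p2 g35 ROUND-45, `r45/Sketch45b.lean`)

Width piece for crux `EulerZoomLiouville.PowerGaugeEulerLiouville` (stmt-NavierStokesRegularity-19832), by name under
LEAD 19832 (ns-typeII-p2 g13); seat ns-ezl-w2 g4, `--supports stmt-NavierStokesRegularity-19832 --as helper`.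

(F′) = (F′₀) ∘ rotation.  For an orthonormal frame `(e₁, e₂, e)` of `ℝ³` let `Rot` be the linear isometry with
`Rot e₁ = b₀`, `Rot e₂ = b₁`, `Rot e = b₂` (`bᵢ = EuclideanSpace.basisFun (Fin 3) ℝ i`; `OrthonormalBasis.equiv` of the
orthonormal basis `![e₁, e₂, e]` with the standard one) and `W := Rot ∘ V ∘ Rot⁻¹` (values rotated too, so that
`⟪W x, b₂⟫ = ⟪V (Rot⁻¹ x), e⟫`).  Then `W ∈ C¹`, its ball budgets are those of `V`
(`setIntegral_ball_comp_linearIsometryEquiv`), `Rot y₀ = plane s (y₀-coordinates)` when `⟪y₀, e⟫ = s`, and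
`Rot⁻¹ ∘ discChart (Rot y₀) b₀ b₁ = discChart y₀ e₁ e₂`; so (F′₀) `Condenser.specksOnQuietSliceCoord` for `W` is (F′) for `V`.

* `exists_frameRotation` — the rotation; `norm_fderiv_conj_linearIsometryEquiv` — `‖D(Rot∘V∘Rot⁻¹)(x)‖ = ‖DV(Rot⁻¹x)‖`;
* **`specksOnQuietSlice`** = `NsregP2.R45.SpecksOnQuietSlice` binder for binder (`E3'` spelled out).

HONEST FRAMING: real analysis in `ℝ³`/`ℂ`; nothing here proves the crux E (19832 OPEN), any door Target, or any
Navier–Stokes statement; no summit statement is touched. [folklore]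
-/

noncomputable section

open Set Filter Topology Metric Function MeasureTheory Real
open scoped RealInnerProductSpace

set_option linter.dupNamespace false

namespace Summit.NavierStokesRegularity.NavierStokesRegularity.Theorems.PowerGaugeEulerLiouville.Condenser

/-! ## §1 The frame rotation -/

/-- **The frame rotation.**  For an orthonormal frame `(e₁, e₂, e)` of `ℝ³` there is a linear isometry `Rot` with
`Rot e₁ = b₀`, `Rot e₂ = b₁`, `Rot e = b₂`. [folklore] -/
theorem exists_frameRotation {e e₁ e₂ : EuclideanSpace ℝ (Fin 3)} (he : ‖e‖ = 1) (he₁ : ‖e₁‖ = 1) (he₂ : ‖e₂‖ = 1)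
    (h12 : ⟪e₁, e₂⟫ = 0) (h1e : ⟪e₁, e⟫ = 0) (h2e : ⟪e₂, e⟫ = 0) :
    ∃ Rot : EuclideanSpace ℝ (Fin 3) ≃ₗᵢ[ℝ] EuclideanSpace ℝ (Fin 3),
      Rot e₁ = EuclideanSpace.basisFun (Fin 3) ℝ 0 ∧ Rot e₂ = EuclideanSpace.basisFun (Fin 3) ℝ 1 ∧
        Rot e = EuclideanSpace.basisFun (Fin 3) ℝ 2 := by
  have h21 : ⟪e₂, e₁⟫ = 0 := by rw [real_inner_comm]; exact h12
  have he1' : ⟪e, e₁⟫ = 0 := by rw [real_inner_comm]; exact h1e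
  have he2' : ⟪e, e₂⟫ = 0 := by rw [real_inner_comm]; exact h2e
  set v : Fin 3 → EuclideanSpace ℝ (Fin 3) := ![e₁, e₂, e] with hv
  have hvo : Orthonormal ℝ v := by
    rw [orthonormal_iff_ite]
    intro i j
    fin_cases i <;> fin_cases j <;> simp [hv, he, he₁, he₂, h12, h21, h1e, h2e, he1', he2']
  have hcard : Fintype.card (Fin 3) = Module.finrank ℝ (EuclideanSpace ℝ (Fin 3)) := by simp
  set bv := basisOfOrthonormalOfCardEqFinrank hvo hcard with hbv
  have hbv_coe : (bv : Fin 3 → EuclideanSpace ℝ (Fin 3)) = v := coe_basisOfOrthonormalOfCardEqFinrank hvo hcard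
  set b : OrthonormalBasis (Fin 3) ℝ (EuclideanSpace ℝ (Fin 3)) := bv.toOrthonormalBasis (by rw [hbv_coe]; exact hvo)
    with hb
  have hb_coe : ∀ i, b i = v i := fun i => by
    rw [hb, Module.Basis.coe_toOrthonormalBasis, hbv_coe]
  refine ⟨b.equiv (EuclideanSpace.basisFun (Fin 3) ℝ) (Equiv.refl _), ?_, ?_, ?_⟩
  · have h := b.equiv_apply_basis (EuclideanSpace.basisFun (Fin 3) ℝ) (Equiv.refl _) 0
    rw [hb_coe] at h
    simpa [hv] using h
  · have h := b.equiv_apply_basis (EuclideanSpace.basisFun (Fin 3) ℝ) (Equiv.refl _) 1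
    rw [hb_coe] at h
    simpa [hv] using h
  · have h := b.equiv_apply_basis (EuclideanSpace.basisFun (Fin 3) ℝ) (Equiv.refl _) 2
    rw [hb_coe] at h
    simpa [hv] using h

/-- Conjugation by a linear isometry does not change the size of the derivative:
`‖D(Rot ∘ V ∘ Rot⁻¹)(x)‖ = ‖DV(Rot⁻¹ x)‖`. [folklore] -/
theorem norm_fderiv_conj_linearIsometryEquiv (V : EuclideanSpace ℝ (Fin 3) → EuclideanSpace ℝ (Fin 3))
    (Rot : EuclideanSpace ℝ (Fin 3) ≃ₗᵢ[ℝ] EuclideanSpace ℝ (Fin 3)) (x : EuclideanSpace ℝ (Fin 3)) :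
    ‖fderiv ℝ (fun z => Rot (V (Rot.symm z))) x‖ = ‖fderiv ℝ V (Rot.symm x)‖ := by
  have hcomp : (fun z => Rot (V (Rot.symm z))) = (Rot.toContinuousLinearEquiv : _ → _) ∘ fun z => V (Rot.symm z) := by
    funext z; simp
  rw [hcomp, Rot.toContinuousLinearEquiv.comp_fderiv, ← norm_fderiv_comp_linearIsometryEquiv V Rot x]
  refine ContinuousLinearMap.opNorm_ext _ _ fun w => ?_
  simp

/-! ## §2 The slice corollary of LEMMA F, general frame -/

/-- **`NsregP2.R45.SpecksOnQuietSlice`, binder for binder** (Sketch45b of nsreg-p2 g35, plate t47-F′; `E3'` spelled out).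
SPECKS ON THE QUIET SLICE: for `κ' < κ_F(Λ,θ) = πθ²γ²(Λ³−1)/(6(Λ+1)^{1−ρ}C_E)` and `R ≥ R₁`, under the ball budgets on
`B(0,(Λ+1)R)`, for every orthonormal frame `(e, e₁, e₂)` there is ONE height `s ∈ [R,ΛR]` such that at every base point `y₀`
(`⟪y₀,e⟫ = s`, `‖y₀‖ ≤ ΛR`), every connected planar `K ∋ 0` of radius `d ≤ R/(4e)` reaching every radius `< d`, with
`θγs ≤ −⟪V(discChart y₀ e₁ e₂ z), e⟫` on `K`, has `d ≤ R·exp(−κ'R^{2+ρ})`.  [(F′₀) `specksOnQuietSliceCoord` for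
`W = Rot ∘ V ∘ Rot⁻¹`, `Rot` = `exists_frameRotation`.] [folklore] -/
theorem specksOnQuietSlice :
    ∀ (γ ρ C_A C_E Λ θ κ' : ℝ), 0 < γ → 0 ≤ ρ → 0 < C_A → 0 < C_E → 1 < Λ → 0 < θ →
      κ' < Real.pi * θ ^ 2 * γ ^ 2 * (Λ ^ 3 - 1) / (6 * (Λ + 1) ^ (1 - ρ) * C_E) →
      ∃ R₁ : ℝ, 0 < R₁ ∧
        ∀ (V : EuclideanSpace ℝ (Fin 3) → EuclideanSpace ℝ (Fin 3)), ContDiff ℝ 1 V →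
          ∀ R : ℝ, R₁ ≤ R →
            (∫ x in ball (0 : EuclideanSpace ℝ (Fin 3)) ((Λ + 1) * R), ‖V x‖ ^ 2 ≤
              C_A * ((Λ + 1) * R) ^ (1 - 2 * ρ)) →
            (∫ x in ball (0 : EuclideanSpace ℝ (Fin 3)) ((Λ + 1) * R), ‖fderiv ℝ V x‖ ^ 2 ≤
              C_E * ((Λ + 1) * R) ^ (1 - ρ)) →
            ∀ (e e₁ e₂ : EuclideanSpace ℝ (Fin 3)), ‖e‖ = 1 → ‖e₁‖ = 1 → ‖e₂‖ = 1 → ⟪e₁, e₂⟫ = 0 → ⟪e₁, e⟫ = 0 →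
              ⟪e₂, e⟫ = 0 →
              ∃ s ∈ Icc R (Λ * R),
                ∀ (y₀ : EuclideanSpace ℝ (Fin 3)), ⟪y₀, e⟫ = s → ‖y₀‖ ≤ Λ * R →
                  ∀ (K : Set ℂ) (d : ℝ), IsConnected K → (0 : ℂ) ∈ K → 0 < d → d ≤ R / (4 * Real.exp 1) →
                    K ⊆ closedBall (0 : ℂ) d → (∀ δ : ℝ, δ < d → ∃ z ∈ K, δ < ‖z‖) →
                    (∀ z ∈ K, θ * γ * s ≤ -⟪V (NeedleDiscChart.discChart y₀ e₁ e₂ z), e⟫) →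
                    d ≤ R * Real.exp (-(κ' * R ^ (2 + ρ))) := by
  intro γ ρ C_A C_E Λ θ κ' hγ hρ hCA hCE hΛ hθ hκ'
  obtain ⟨R₁, hR₁, hF0⟩ := specksOnQuietSliceCoord γ ρ C_A C_E Λ θ κ' hγ hρ hCA hCE hΛ hθ hκ'
  refine ⟨R₁, hR₁, fun V hV R hR hA hE e e₁ e₂ he he₁ he₂ h12 h1e h2e => ?_⟩
  -- the frame rotation and the conjugated field
  obtain ⟨Rot, hR0e, hR1e, hR2e⟩ := exists_frameRotation he he₁ he₂ h12 h1e h2e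
  set W : EuclideanSpace ℝ (Fin 3) → EuclideanSpace ℝ (Fin 3) := fun x => Rot (V (Rot.symm x)) with hW
  have hWc : ContDiff ℝ 1 W :=
    Rot.toContinuousLinearEquiv.contDiff.comp (hV.comp Rot.symm.toContinuousLinearEquiv.contDiff)
  have hWn : ∀ x, ‖W x‖ = ‖V (Rot.symm x)‖ := fun x => Rot.norm_map _
  have hDW : ∀ x, ‖fderiv ℝ W x‖ = ‖fderiv ℝ V (Rot.symm x)‖ := norm_fderiv_conj_linearIsometryEquiv V Rot
  have hA' : ∫ x in ball (0 : EuclideanSpace ℝ (Fin 3)) ((Λ + 1) * R), ‖W x‖ ^ 2 ≤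
      C_A * ((Λ + 1) * R) ^ (1 - 2 * ρ) := by
    simp_rw [hWn]
    rw [setIntegral_ball_comp_linearIsometryEquiv (fun x => ‖V x‖ ^ 2) Rot ((Λ + 1) * R)]
    exact hA
  have hE' : ∫ x in ball (0 : EuclideanSpace ℝ (Fin 3)) ((Λ + 1) * R), ‖fderiv ℝ W x‖ ^ 2 ≤
      C_E * ((Λ + 1) * R) ^ (1 - ρ) := by
    simp_rw [hDW]
    rw [setIntegral_ball_comp_linearIsometryEquiv (fun x => ‖fderiv ℝ V x‖ ^ 2) Rot ((Λ + 1) * R)]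
    exact hE
  -- (F′₀) for `W`
  obtain ⟨s, hs, hmain⟩ := hF0 W hWc R hR hA' hE'
  refine ⟨s, hs, fun y₀ hy₀e hy₀n K d hK h0K hd hdR hKd hreach hfast => ?_⟩
  -- the rotated base point is `plane s a₀`
  set y' : EuclideanSpace ℝ (Fin 3) := Rot y₀ with hy'
  have hy'2 : y' 2 = s := by
    rw [← EuclideanSpace.inner_basisFun_real, ← hR2e, hy', Rot.inner_map_map, hy₀e]
  set a₀ : EuclideanSpace ℝ (Fin 2) := WithLp.toLp 2 ![y' 0, y' 1] with ha₀
  have hplane : plane s a₀ = y' := by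
    ext i
    fin_cases i
    · simp [ha₀]
    · simp [ha₀]
    · simpa using hy'2.symm
  have hnorm : ‖plane s a₀‖ ≤ Λ * R := by
    rw [hplane, hy', Rot.norm_map]; exact hy₀n
  -- the chart identity `Rot⁻¹ (discChart y' b₀ b₁ z) = discChart y₀ e₁ e₂ z`
  have hchart : ∀ z : ℂ, Rot.symm (NeedleDiscChart.discChart y' (EuclideanSpace.basisFun (Fin 3) ℝ 0)
      (EuclideanSpace.basisFun (Fin 3) ℝ 1) z) = NeedleDiscChart.discChart y₀ e₁ e₂ z := by
    intro z
    simp only [NeedleDiscChart.discChart, map_add, LinearIsometryEquiv.map_smul, ← hR0e, ← hR1e, hy',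
      LinearIsometryEquiv.symm_apply_apply]
  have hfast' : ∀ z ∈ K, θ * γ * s ≤
      -(W (NeedleDiscChart.discChart (plane s a₀) (EuclideanSpace.basisFun (Fin 3) ℝ 0)
        (EuclideanSpace.basisFun (Fin 3) ℝ 1) z)) 2 := by
    intro z hz
    have h2 : (W (NeedleDiscChart.discChart (plane s a₀) (EuclideanSpace.basisFun (Fin 3) ℝ 0)
        (EuclideanSpace.basisFun (Fin 3) ℝ 1) z)) 2 = ⟪V (NeedleDiscChart.discChart y₀ e₁ e₂ z), e⟫ := by
      rw [← EuclideanSpace.inner_basisFun_real, ← hR2e, hplane, hW]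
      simp only
      rw [Rot.inner_map_map, hchart]
    rw [h2]
    exact hfast z hz
  exact hmain a₀ hnorm K d hK h0K hd hdR hKd hreach hfast'

end Summit.NavierStokesRegularity.NavierStokesRegularity.Theorems.PowerGaugeEulerLiouville.Condenser

end
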